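import Summits.QuantumFields.BalabanUV.Beta.EriceFlowEnclosureB12AsPrintedPointwiseFadingEventualAFEnd
import Summits.QuantumFields.BalabanUV.Beta.EriceFlowEnclosureB12AsPrintedHistoryContagionShiftWitness

/-!
# Beta / EriceFlowEnclosureB12AsPrintedPointwiseFadingEventualAFNonvacuous — WHAT (0.31) FORCES, part 10e: THE EVENTUAL LETTER IS THE SHARP GRADE, NON-VACUOUSLY.  On ONE def-free
# setting of [I] as typed — part 8b's RAMP SETTING (#61g `rampToy_exists`: β_2(g₀, g₁) = g₁(2g₁ − g₀), β_{k+1} ≡ 1 otherwise) — EVERY hypothesis of parts 10 ∕ 10b ∕ 10c holds AT ONCE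
# (`StandingHypotheses ∧ Definitions ∧ Conclusions`, `Theorem2Statement` AS TYPED, prover 1's binder `hrg`, node U2's `HistLipschitz` with `FadingMemory` at θ = ½, NE4 `ScaleShiftRate (7∕2) ½`
# — bflow-p1 #64d `scaleShiftRate_ramp`), the ALL-SCALES pointwise letter FAILS at every level (`¬ BetaLowerH b γ S.β` for every b ≥ 0, γ > 0: the sign is not forced, #61g) and the g-UNIFORM
# (0.31) FAILS, and YET the three conclusions hold: crew CAP's carrier `BetaAvgAFH s D δ S.β` near zero (part 10), node U2's EVENTUAL letter `EventualLowerH b δ k₀ S.β` near zero (part 10b), and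
# node U2's FULL `ContinuumRunning` package incl. `.lower` for every pinned family in a small box (part 10c).  So on the typed interface under node U2's moduli + NE4 the EVENTUAL pointwise grade
# is EXACTLY what (0.31) forces: strictly between the averaged carrier (forced without NE4) and the all-scales letter (not forced even with NE4)
# (β-flow team, prover 2 = lower ∕ positivity side, unit `b2b-balaban-beta-bflow-p2`, gen 46; ROW AP-I × node U2's letters; non-vacuity side of parts 10–10c; the NE4 letter of the ramp is bflow-p1's)

HONEST FRAMING (page 1 of everything the β sub-cell writes): discharging `BetaPertH` makes Bałaban's UV stability UNCONDITIONAL — a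
real constructive-QFT result; it is NOT the continuum limit and NOT the Clay problem.  HONEST DEPENDENCY (cell reorg 2026-08-19,
verbatim): «continuum YM on T⁴ ⇐ BetaPertH ∧ nine spine estimates (0/9 proved); BetaPertH ⇐ (D1) ∧ (D4) ∧ CAP+tail; G-an2-4 gates
asym, D1 and NE2/3/4.»  THIS MODULE DISCHARGES NOTHING: ONE TOY setting (ours, part 8b; NOT Bałaban's β) on which the HYPOTHESIS SHAPES of [I]'s typing `B12BetaAsPrinted` ([Balaban1987RG1]
as typed; `Theorem2Statement` STATED WITHOUT PROOF in print, p. 259 — PROVED FOR THE TOY in part 8a) and node U2's `HistLipschitz ∕ FadingMemory ∕ ScaleShiftRate ∕ EventualLowerH` and crew CAP's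
`BetaAvgAFH` are evaluated; assembled BY NAME from #61g, bflow-p1 #64d and parts 10–10c.  Nothing of Bałaban's objects is asserted.

WHAT THIS FILE PROVES (0 sorry, 0 def): **`eventualAF_typed_nonvacuous_sharp`** (the ramp setting: all hypotheses ∧ ¬`BetaLowerH b γ` ∀ b ≥ 0 ∀ γ > 0 ∧ the three conclusions of parts 10 ∕ 10b ∕ 10c),
`eventual_not_allScales` (schema: «typed Theorem 2 + `Definitions` + `hrg` + moduli + NE4 ⟹ `BetaSignH`» is FALSE while «… ⟹ ∃ b > 0, δ > 0, k₀, `EventualLowerH b δ k₀`» is part 10b's theorem).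
NOT CLAIMED: anything about Bałaban's β; Theorem 2; `BetaPertH`; continuum; Clay.
-/

namespace Summit.QuantumFields.BalabanUV.Beta.EriceFlowEnclosureB12AsPrintedPointwiseFadingEventualAFNonvacuous

open Literature.MathematicalPhysics.QuantumFieldTheory.Balaban1983to89
open Literature.MathematicalPhysics.QuantumFieldTheory.Balaban1983to89.B12BetaAsPrinted
open Literature.MathematicalPhysics.QuantumFieldTheory.Balaban1983to89.FlowStep (HBeta Box mem_box RGEqH BetaLowerH BetaSignH)
open Literature.MathematicalPhysics.QuantumFieldTheory.Balaban1983to89.T4CouplingMatching (HistLipschitz FadingMemory ScaleShiftRate EventualLowerH)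
open Literature.MathematicalPhysics.QuantumFieldTheory.Balaban1983to89.T4ContinuumCoupling (ContinuumRunning)
open Literature.MathematicalPhysics.QuantumFieldTheory.Balaban1983to89.Beta.AveragedAFCarrier (BetaAvgAFH)
open Summit.QuantumFields.BalabanUV.Beta.EriceFlowEnclosureB12AsPrintedPointwiseFadingSignFamily (letters_ramp theorem2_typed_ramp histLipschitz_ramp
  fadingMemory_ramp not_betaSignH_ramp)
open Summit.QuantumFields.BalabanUV.Beta.EriceFlowEnclosureB12AsPrintedPointwiseFadingSignWitness (rampToy_exists)
open Summit.QuantumFields.BalabanUV.Beta.EriceFlowEnclosureB12AsPrintedHistoryContagionShiftWitness (scaleShiftRate_ramp)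
open Summit.QuantumFields.BalabanUV.Beta.EriceFlowEnclosureB12AsPrintedPointwiseFadingDrift (exists_betaAvgAFH_of_theorem2_fadingMemory)
open Summit.QuantumFields.BalabanUV.Beta.EriceFlowEnclosureB12AsPrintedPointwiseFadingEventualAF (eventualLowerH_of_theorem2_fadingMemory_NE4)
open Summit.QuantumFields.BalabanUV.Beta.EriceFlowEnclosureB12AsPrintedPointwiseFadingEventualAFEnd (continuumRunning_smallBox_of_typedTheorem2)

noncomputable section

/-- **THE EVENTUAL LETTER IS THE SHARP GRADE — NON-VACUOUSLY, ON ONE SETTING.**  The ramp setting of part 8b carries: [I]'s typed content (`StandingHypotheses`, `Definitions`, `Conclusions`),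
`Theorem2Statement` AS TYPED, `hrg` on ]0, ½], `HistLipschitz Λ ½ S.β` with `FadingMemory 5 ½ Λ`, NE4 `ScaleShiftRate (7∕2) ½ ½ S.β`; the ALL-SCALES pointwise letter fails for EVERY b ≥ 0 on EVERY box
(`¬ BetaLowerH b γ S.β`); and nevertheless (parts 10 ∕ 10b ∕ 10c BY NAME): `∃ s > 0, D, δ ∈ ]0, ½], BetaAvgAFH s D δ S.β`; `∃ b > 0, δ ∈ ]0, ½], k₀, EventualLowerH b δ k₀ S.β`; and ∃ b > 0 such that below
every cap some box δ′ carries node U2's FULL package `ContinuumRunning S.β g g_IR δ′ b` (incl. `.lower`) for EVERY pinned family of runs in ]0, δ′]. [folklore] -/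
theorem eventualAF_typed_nonvacuous_sharp :
    ∃ (S : Setting) (hH : StandingHypotheses S), Definitions S ∧ Conclusions S ∧ Theorem2Statement S (hL_of_standing hH) ∧
      (∀ P : B12.RunParams, Step.InInterval (1 / 2) P.K (S.cpl P) → RGEqH P.K S.β (S.cpl P)) ∧
      HistLipschitz (fun k _ => if k = 1 then 5 * (1 / 2 : ℝ) else 0) (1 / 2) S.β ∧
      FadingMemory (5 * (1 / 2) / (1 / 2)) (1 / 2) (fun k _ => if k = 1 then 5 * (1 / 2 : ℝ) else 0) ∧
      ScaleShiftRate (7 / 2) (1 / 2) (1 / 2) S.β ∧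
      (∀ b γ : ℝ, 0 ≤ b → 0 < γ → ¬ BetaLowerH b γ S.β) ∧
      (∃ s : ℝ, 0 < s ∧ ∃ D δ : ℝ, 0 < δ ∧ δ ≤ 1 / 2 ∧ BetaAvgAFH s D δ S.β) ∧
      (∃ b : ℝ, 0 < b ∧ ∃ δ : ℝ, 0 < δ ∧ δ ≤ 1 / 2 ∧ ∃ k₀ : ℕ, EventualLowerH b δ k₀ S.β) ∧
      (∃ b : ℝ, 0 < b ∧ ∀ γ₀ : ℝ, 0 < γ₀ → ∃ δ' : ℝ, 0 < δ' ∧ δ' ≤ 1 / 2 ∧ δ' ≤ γ₀ ∧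
        ∀ (g : ℕ → ℕ → ℝ) (gIR : ℝ), (∀ K, RGEqH K S.β (g K)) → (∀ K i, i ≤ K → 0 < g K i ∧ g K i ≤ δ') → (∀ K, g K K = gIR) →
          ContinuumRunning S.β g gIR δ' b) := by
  obtain ⟨S, hH, hD, hC, hγ, hβ⟩ := rampToy_exists
  obtain ⟨-, -, -, hrg⟩ := letters_ramp hβ
  have hT := theorem2_typed_ramp hβ hH hD
  have hL := histLipschitz_ramp hβ (by norm_num : (0 : ℝ) ≤ 1 / 2)
  have hΛ := fadingMemory_ramp (γ := 1 / 2) (θ := 1 / 2) (by norm_num) (by norm_num) (by norm_num)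
  have hS := scaleShiftRate_ramp hβ
  have hnolo : ∀ b γ : ℝ, 0 ≤ b → 0 < γ → ¬ BetaLowerH b γ S.β := fun b γ hb hγ0 hlo =>
    not_betaSignH_ramp hβ ⟨γ, hγ0, fun k v hv => hb.trans (hlo k v hv)⟩
  have h12 : (0 : ℝ) < 1 / 2 := by norm_num
  have hθ0 : (0 : ℝ) ≤ 1 / 2 := by norm_num
  have hθ1 : (1 / 2 : ℝ) < 1 := by norm_num
  have hC5 : (0 : ℝ) ≤ 5 * (1 / 2) / (1 / 2) := by norm_num
  exact ⟨S, hH, hD, hC, hT, hrg hD, hL, hΛ, hS, hnolo,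
    exists_betaAvgAFH_of_theorem2_fadingMemory hT h12 hθ0 hθ1 hC5 (hrg hD) hL hΛ,
    eventualLowerH_of_theorem2_fadingMemory_NE4 hT h12 hθ0 hθ1 hC5 (hrg hD) hL hΛ hS,
    continuumRunning_smallBox_of_typedTheorem2 hT h12 h12 hθ1 hC5 (by norm_num) (hrg hD) hL hΛ hS⟩

/-- **SCHEMA FORM.**  «typed Theorem 2 + [I]'s typed content + `hrg` + node U2's moduli (θ < 1) + NE4 ⟹ the SIGN of β on some box (`BetaSignH`)» is FALSE (the ramp setting), while the same
hypotheses DO give `∃ b > 0, δ > 0, k₀, EventualLowerH b δ k₀` (part 10b `eventualLowerH_of_theorem2_fadingMemory_NE4`): the eventual index k₀ is load-bearing. [folklore] -/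
theorem eventual_not_allScales :
    ¬ (∀ (S : Setting) (hH : StandingHypotheses S), Definitions S → Conclusions S → Theorem2Statement S (hL_of_standing hH) →
        ∀ (γU C c θ : ℝ) (Λ : ℕ → ℕ → ℝ), 0 < γU → 0 ≤ θ → θ < 1 → 0 ≤ C →
          (∀ P : B12.RunParams, Step.InInterval γU P.K (S.cpl P) → RGEqH P.K S.β (S.cpl P)) →
          HistLipschitz Λ γU S.β → FadingMemory C θ Λ → ScaleShiftRate c θ γU S.β → BetaSignH S.β) := by
  intro h
  obtain ⟨S, hH, hD, hC, hT, hrg, hL, hΛ, hS, hnolo, -⟩ := eventualAF_typed_nonvacuous_sharp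
  obtain ⟨γ₀, hγ₀, hlo⟩ := h S hH hD hC hT (1 / 2) (5 * (1 / 2) / (1 / 2)) (7 / 2) (1 / 2) _ (by norm_num) (by norm_num) (by norm_num) (by norm_num)
    hrg hL hΛ hS
  exact hnolo 0 γ₀ le_rfl hγ₀ hlo

end

end Summit.QuantumFields.BalabanUV.Beta.EriceFlowEnclosureB12AsPrintedPointwiseFadingEventualAFNonvacuous
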